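import Mathlib.Data.Nat.Cast.Basic
import Literature.IUT.HodgeArakelov.KummerPrimeStripsNonVacuity
import Literature.IUT.HodgeArakelov.LocalTriMuDataIsoArch
import HarnessLib

/-!
# [IUTchII] Def 4.9 (viii): NON-VACUITY of the frozen records `FVdashTriMuPrimeStrip` (the `F^{⊩▶×μ}`-prime-strip
# with its pilot object) and `FVdashTriMuIso` (isomorphisms of such strips) — proof-only

NV-L6 wave (abc-iut cell, L6-lead §F v1.18p «NV-L6 WAVE», plan/ADJUDICATION-SPEC §4(iii); seat abc-iut-w4-d005; row
«NV-L6 FVdashTriMuPrimeStrip, FVdashTriMuIso»; census abc-iut-w5-d114 INHABITATION-CENSUS-L6-v3 §A: both records of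
`Literature/IUT/HodgeArakelov/KummerPrimeStrips.lean` (abc-iut-L6-t2, p405008, FROZEN) have ZERO producers in the tree —
the Fintype-free successors `FVdashTriMuPrimeStripF` / `FVdashTriMuIsoF` (`RealifiedPrimeStripsFinsupp.lean`) are only
reached FROM them by `toF`). No definitions: the witnesses are built inside the theorem terms.

S. Mochizuki, *Inter-universal Teichmüller theory II*, kurims manuscript (Dec 2020), Def 4.9 (viii) p. 158 (own render
`paper:url-5036b4059555/p0158.txt`): "an `F^{⊩▶×μ}`-prime-strip is a collection of data
`*F^{⊩▶×μ} = (*C^⊩, Prime(*C^⊩) ⥲ V̲, *F^{⊢▶×μ}, {*ρ_v}_{v∈V̲})` satisfying the conditions (a), (b), (c), (d), (e), (f) of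
[IUTchI], Definition 5.2, (iv) … the generators of the monoids «`O^▶(−)`» [each of which is abstractly isomorphic to `ℕ`] of
the data at `v ∈ V̲^{bad}`, together with the `{*ρ_w}_{w∈V̲}`, determine … a well-defined object, up to isomorphism, … of
negative «arithmetic degree» … pilot object. A morphism of `F^{⊩▶×μ}`-prime-strips is defined to be an isomorphism between
collections of data as discussed above." Claim key `Mochizuki2012` DISPUTED (D-0012); [cite: Mochizuki2012, Def 4.9 (viii) p.158].

WITNESSES (HONEST LABEL: **DEGENERATE / TOY index** — the frozen record carries `[Fintype V]`, whereas the genuine index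
`V̲ ⥲ V_mod` is infinite (`InitialThetaData.isEmpty_fintype_V`, L6/L5 ruling D13); so EVERY inhabitant of THIS record has a
truncated index by design, and the genuine-index carrier is the Fintype-free successor):
* `FVdashTriMuPrimeStrip.nonempty_degenerate (Γ) (l)`: ONE place, of BAD type (`V := PUnit`; [IUTchI] Def 3.1 (b)
  `V̲^{bad} ≠ ∅`), any group `Γ` acting trivially; local datum `‡F^{⊢▶×μ}_v` = abc-iut-L6-t2's `NonarchTriMuDatum` on the
  monoid `O^▷ := ℕ·ϖ` (`Multiplicative ℕ`: FREE OF RANK ONE with TRIVIAL units — the `O^▶ ≅ ℕ` clause on the nose, the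
  unit group degenerate), splitting `:= ⊤`, presentation `O^⊥/μ_{2l} = O^▷/O^×` PROVED (`rootsOfUnity = 1`), the
  TAUTOLOGICAL Kummer structures of `KummerPrimeStripsNonVacuity.lean` (abc-iut-L6-d7: `nonempty_kummerTimes(_Mu)_tautological`);
  `*C^⊩` := the realified Frobenioid SHADOW with objects `V → ℝ` (local degrees), `Iso := Eq`, `deg := Σ_v`; `ρ_v` := the
  DEGREE `n·ϖ ↦ n` read through `Associates (ℕ·ϖ) ≅ ℕ·ϖ` (trivial units: `Associates.mk_injective`); generator `ϖ`,
  `ρ_v(ϖ) = 1 > 0`; pilot object `:= (v ↦ −1)`, of arithmetic degree `−1 < 0` (the record's PROVED `pilot_deg_neg` applies).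
* `FVdashTriMuIso.nonempty_degenerate`: the identity isomorphism of that strip, over the GENUINE local isomorphism
  relation `Nonempty (LocalTriMuDatum.Iso D D')` of abc-iut-L6-t2's `LocalTriMuDataIsoArch.lean` (`Iso.refl`).
What the witnesses certify: the twelve fields of `FVdashTriMuPrimeStrip` (incl. `rho_triGen_pos`, `pilot_localDeg_bad/_other`
against `deg_eq_sum`) and the five of `FVdashTriMuIso` are JOINTLY SATISFIABLE — §4(iii) «not yet witnessed» becomes
«witnessed (degenerate index)»; a genuine-index witness belongs to `FVdashTriMuPrimeStripF` (kit rule / model strips,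
abc-iut-L6-t2 `RealifiedPrimeStripSplitKitRuleWitness`). HONEST FRAMING: nothing here asserts a disputed claim or takes a
side on [IUTchIII] Cor 3.12. No new Prop fact, no def/instance.
-/

namespace Literature.IUT.HodgeArakelov

open scoped NNReal

/-- **IUTchII:Def4.9(viii)** (kurims p. 158) NON-VACUITY (DEGENERATE index: one bad place, `[Fintype V]` record) of the
`F^{⊩▶×μ}`-prime-strip record WITH its pilot object AND of the record of ISOMORPHISMS of such strips: for every prime `l`
and every group `Γ` there are group-theoretic units `X`, an inhabitant `S` of `FVdashTriMuPrimeStrip ⟨l, bad, _⟩ (fun _ => Γ) X`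
— local datum on `O^▷ = ℕ·ϖ` (`Multiplicative ℕ`, trivial units, splitting `⊤`, tautological Kummer structures), realified
shadow `Obj := V → ℝ` with `Iso := Eq`, `ρ_v = degree`, generator `ϖ` with `ρ_v(ϖ) = 1 > 0`, pilot `≡ −1` — and the identity
isomorphism `S ⥲ S` over the GENUINE local isomorphism relation `Nonempty (LocalTriMuDatum.Iso D D')` (abc-iut-L6-t2,
`LocalTriMuDataIsoArch.lean`, `Iso.refl`). [claim: Mochizuki2012, status: disputed] -/
theorem FVdashTriMuIso.nonempty_degenerate (Γ : Type) [Group Γ] (l : ℕ) :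
    ∃ (X : PUnit.{1} → GroupTheoreticUnits.{0, 0} Γ)
      (S : FVdashTriMuPrimeStrip.{0, 0, 0} (⟨l, fun _ => PlaceKind.bad, ⟨PUnit.unit, rfl⟩⟩ : PlaceData PUnit.{1})
        (fun _ => Γ) X),
      Nonempty (FVdashTriMuIso (fun _ D D' => Nonempty (LocalTriMuDatum.Iso D D')) S S) := by
  classical
  -- the monoid `O^▷ := ℕ·ϖ` with the trivial `Γ`-action, and the tautological group-theoretic units on `O^×`
  let M : CoveringMonoid.{0, 0} Γ := ⟨CommMonCat.of (Multiplicative ℕ), 1⟩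
  let X : GroupTheoreticUnits.{0, 0} Γ :=
    { OxG := M.Oˣ, act := M.unitsAct, openSubgroups := Set.univ, zhatUnits := ⊥,
      zhatUnits_comm := fun γ hγ g => by rw [Subgroup.mem_bot.mp hγ, one_mul, mul_one] }
  obtain ⟨κ⟩ := nonempty_kummerTimes_tautological Γ M Set.univ
  obtain ⟨κμ⟩ := nonempty_kummerTimesMu_tautological Γ M Set.univ
  -- units of `ℕ·ϖ` are trivial
  have hunit : ∀ u : (Multiplicative ℕ)ˣ, (u : Multiplicative ℕ) = 1 := fun u => by
    have h : Multiplicative.toAdd (u : Multiplicative ℕ) + Multiplicative.toAdd (↑u⁻¹ : Multiplicative ℕ) = 0 :=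
      congrArg Multiplicative.toAdd u.val_inv
    exact congrArg Multiplicative.ofAdd (Nat.eq_zero_of_add_eq_zero_right h)
  haveI hsub : Subsingleton (Multiplicative ℕ)ˣ :=
    ⟨fun a b => Units.ext ((hunit a).trans (hunit b).symm)⟩
  have hroots : ∀ ζ : (Multiplicative ℕ)ˣ, ζ ∈ rootsOfUnity (torsionOrder l PlaceKind.bad) (Multiplicative ℕ) →
      (ζ : Multiplicative ℕ) = 1 := fun ζ _ => hunit ζ
  -- the presentation `O^⊥/μ_{2l} = O^▷/O^×` for the splitting `⊤`
  have hpres : OPerpPresentsAssociates (Multiplicative ℕ) (torsionOrder l PlaceKind.bad) ⊤ := by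
    refine ⟨fun a => ?_, fun x _ y _ => ?_⟩
    · obtain ⟨x, rfl⟩ := Associates.mk_surjective a
      exact ⟨x, splitting_le_OPerp _ _ _ (Submonoid.mem_top x), rfl⟩
    · constructor
      · intro h
        have hxy : x = y := Associates.mk_injective h
        exact ⟨1, one_mem _, by rw [hxy, Units.val_one, one_mul]⟩
      · rintro ⟨ζ, hζ, rfl⟩
        rw [hroots ζ hζ, one_mul]
  -- the bad local datum and the degree `ρ_v : Associates (ℕ·ϖ) ≅ ℕ·ϖ → (ℝ≥0, +)`
  let D : NonarchTriMuDatum.{0, 0, 0} l PlaceKind.bad Γ X :=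
    ⟨CommMonCat.of (Multiplicative ℕ), 1, ⊤, hpres, κ, κμ⟩
  let e : Multiplicative ℕ ≃* Associates (Multiplicative ℕ) :=
    MulEquiv.ofBijective (Associates.mkMonoidHom (M := Multiplicative ℕ))
      ⟨Associates.mk_injective, Associates.mk_surjective⟩
  let ρ : Associates (Multiplicative ℕ) →* Multiplicative ℝ≥0 :=
    (AddMonoidHom.toMultiplicative (Nat.castAddMonoidHom ℝ≥0)).comp e.symm.toMonoidHom
  have hρ : ∀ n : ℕ, ρ (Associates.mk (Multiplicative.ofAdd n)) = Multiplicative.ofAdd (n : ℝ≥0) := fun n => by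
    have h1 : e.symm (Associates.mk (Multiplicative.ofAdd n)) = Multiplicative.ofAdd n :=
      e.symm_apply_eq.mpr rfl
    change AddMonoidHom.toMultiplicative (Nat.castAddMonoidHom ℝ≥0) (e.symm (Associates.mk (Multiplicative.ofAdd n))) = _
    rw [h1]
    rfl
  have hpos : 0 < Multiplicative.toAdd (ρ (Associates.mk (Multiplicative.ofAdd 1))) := by
    rw [hρ 1]; simp
  have hdeg : (-1 : ℝ) = -((Multiplicative.toAdd (ρ (Associates.mk (Multiplicative.ofAdd 1))) : ℝ≥0) : ℝ) := by
    rw [hρ 1]; simp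
  -- the strip with its pilot object
  let S : FVdashTriMuPrimeStrip.{0, 0, 0} (⟨l, fun _ => PlaceKind.bad, ⟨PUnit.unit, rfl⟩⟩ : PlaceData PUnit.{1})
      (fun _ => Γ) (fun _ => X) :=
    { realified :=
        { Obj := PUnit.{1} → ℝ
          Iso := Eq
          deg := fun a => ∑ v, a v
          deg_iso := fun a b h => by rw [h]
          localDeg := fun a v => a v
          deg_eq_sum := fun _ => rfl }
      strip := ⟨fun _ => LocalTriMuDatum.bad D⟩
      rho := fun _ => ρ
      triGen := fun _ _ => Associates.mk (Multiplicative.ofAdd (1 : ℕ))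
      rho_triGen_pos := fun _ _ => hpos
      pilot := fun _ => -1
      pilot_localDeg_bad := fun _ _ => hdeg
      pilot_localDeg_other := fun _ h => (h rfl).elim }
  exact ⟨fun _ => X, S, ⟨{ objEquiv := Equiv.refl _
                           map_iso := fun _ _ => Iff.rfl
                           deg_eq := fun _ => rfl
                           map_pilot := rfl
                           localIso := fun _ => ⟨LocalTriMuDatum.Iso.refl _⟩ }⟩⟩

/-- **IUTchII:Def4.9(viii)** (kurims p. 158) in particular the `F^{⊩▶×μ}`-prime-strip record itself is inhabited (DEGENERATE
index), for every prime `l` and every group `Γ`. [claim: Mochizuki2012, status: disputed] -/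
theorem FVdashTriMuPrimeStrip.nonempty_degenerate (Γ : Type) [Group Γ] (l : ℕ) :
    ∃ X : PUnit.{1} → GroupTheoreticUnits.{0, 0} Γ,
      Nonempty (FVdashTriMuPrimeStrip.{0, 0, 0}
        (⟨l, fun _ => PlaceKind.bad, ⟨PUnit.unit, rfl⟩⟩ : PlaceData PUnit.{1}) (fun _ => Γ) X) := by
  obtain ⟨X, S, -⟩ := FVdashTriMuIso.nonempty_degenerate Γ l
  exact ⟨X, ⟨S⟩⟩

/-- **IUTchII:Def4.9(viii)** (kurims p. 158 «of negative arithmetic degree») the record's PROVED `pilot_deg_neg` is thereby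
exercised on an actual inhabitant: the degenerate strip's pilot object has negative degree. [claim: Mochizuki2012, status: disputed] -/
theorem FVdashTriMuPrimeStrip.exists_pilot_deg_neg (Γ : Type) [Group Γ] (l : ℕ) :
    ∃ (X : PUnit.{1} → GroupTheoreticUnits.{0, 0} Γ)
      (S : FVdashTriMuPrimeStrip.{0, 0, 0} (⟨l, fun _ => PlaceKind.bad, ⟨PUnit.unit, rfl⟩⟩ : PlaceData PUnit.{1})
        (fun _ => Γ) X), S.realified.deg S.pilot < 0 := by
  obtain ⟨X, S, -⟩ := FVdashTriMuIso.nonempty_degenerate Γ l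
  exact ⟨X, S, S.pilot_deg_neg⟩

end Literature.IUT.HodgeArakelov
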